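import Summits.BirchSwinnertonDyer.BirchSwinnertonDyer.Theorems.PrintCf2RamifiedOffTYZMoverBlockFormSix
import Summits.BirchSwinnertonDyer.BirchSwinnertonDyer.Theorems.PrintCf2RamifiedOffTYZMoverParity
import Literature.NumberTheory.QuadraticFields.FourRankOneKernelCriterion
import Literature.NumberTheory.QuadraticFields.RingClassNumber
import HarnessLib

/-!
# Crux `PrintCf2.RamifiedOffTYZOfFacts` (stmt-BirchSwinnertonDyer-20509), line `offtyz-v7`, LEAD cycle 14 (cruxlead-20509 g13):
# THE REGIME-FREE BLOCK FORM ON A BLOCK `d ≡ 6 (mod 8)`, PART I — Frobenius-row linear algebra and the ring class group side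

THEOREMS ONLY (no `def`, no named fact, no `sorry`), `--supports stmt-BirchSwinnertonDyer-20509`.

g8's block form `sqMotion_eq_kerSum_dotProduct_bits_six` (`χ_d(g) = kerSum(N_d)·x_d(g)`, `N_d = [[A_d + D₋₂, z_d],[0,0]]` on `Fin m ⊕ Unit`) carries the
GENUS-REGIME hypotheses `Odd (gK d)` and `#ker N_d = 2`; outside that regime the character `χ_d(g) = [(g·g)^{g(d)} ≡ σ_d]` of a block
`d = 2q₁⋯q_m ≡ 6 (mod 8)` was treated by the lineage as «not display-determined» (LEAD g9/g10/g12).  It IS display-determined: in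
`G = Pic(𝒪₄) = Gal(H′_d/K_d)` (ring class dictionary `ρ₄`, (RC1)–(RC3)) the bit map `g ↦ x_d(g)` is onto `𝔽₂^{m+1}` with kernel the squares, so
`#G[2] = #(G/G²) = 2^{m+1}`; when the Frobenius rows of `N_d` are independent (`⟺ #ker N_d = 2`) the involutions `σ_d, φ_{q_1}, …, φ_{q_m}`
generate `G[2]`, hence `(G²)[2] = {1, σ_d}` and the tree's `FourRankOne.exists_pow_eq_of_forall_sq_eq_one` produces an element with `χ_d = 1`
WITHOUT `g(d)` odd; when they are dependent a product `∏_{q∈U} φ_q` is an `L_d(i)`-trivial involution outside `Gal(ℍ′_n/H_d)` (class values (F4))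
and `χ_d ≡ 0 = kerSum(N_d)` (g12's transfer lemma).  This file supplies the two ingredients that are independent of the case split:
* §1 (linear algebra over `𝔽₂`, any square matrix on `Fin m ⊕ Unit` with zero last row): `#ker N = 2` ⟹ the first `m` rows are linearly
  independent (`eq_zero_of_sum_smul_row_eq_zero`); `#ker N ≠ 2` ⟹ a non-trivial relation `Σ_{j∈U} N_j = 0` (`exists_sum_smul_row_eq_zero`).
* §2 (the block, through `ρ₄`): bits vanish iff `L_d(i)`-trivial iff `ρ₄(g)` is a square (RC3); bits factor through `ρ₄` (RC1); `χ_d(g) = 1 ⟺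
  ρ₄(g)^{2g(d)} = ρ₄(σ)`; the subgroup of squares of `Pic(𝒪₄)` has order `2g(d)` ((G7) transported through `ρ₄`); `ρ₄(σ)` is a square `≠ 1` of
  square `1` (`θθ ≡ σ`, (G6)).
The block form itself is the sequel `…MoverBlockFormSixAll`.  BSD is not proved by any of this; no class is closed by this file.

References: [cite: TianYuanZhang2017, §3.1 (p0011 L1–L13, L53–L64), Prop. 3.2 (2) (p0010 L111–L113), Thm. 3.6 (2), proof of Lemma 3.21 (p0020 L50–L63)];
[cite: Cox2013, §7.D Thm. 7.24, §9.A (pp. 180–181), §5.C Lemma 5.19, (5.22)]; [cite: Rotman1995, Thm. 2.19 (PDF p. 37)];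
[cite: Stevenhagen1995RedeiMatrices, §2]; crux workfile `Lines/offtyz_v7_EvenTwoPrimes.md` §5, §11 (cruxlead-20509 g12).
-/

noncomputable section

open scoped Classical NumberField

open WeierstrassCurve WeierstrassCurve.Affine Finset Matrix Literature.NumberTheory.EllipticCurves
  Literature.NumberTheory.EllipticCurves.TianYuanZhang2017
  Literature.NumberTheory.EllipticCurves.TianYuanZhang2017.W2
  Literature.NumberTheory.EllipticCurves.HeathBrown1994
  Literature.NumberTheory.EllipticCurves.HeathBrown1994.Families
  Literature.NumberTheory.EllipticCurves.Smith2016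
  Literature.NumberTheory.QuadraticFields.RingClass
  Literature.NumberTheory.QuadraticFields
  Summit.BirchSwinnertonDyer.Rank1Residual.P2.GenusPeriodTransferLayer
  Summit.BirchSwinnertonDyer.PrintCf2.QForm

set_option autoImplicit false

namespace Summit.BirchSwinnertonDyer.PrintCf2.MoverAssembly

/-! ## §1 Linear algebra: the Frobenius rows of a square matrix on `Fin m ⊕ Unit` with zero last row -/

section LinearAlgebra

variable {m : ℕ} (N : Matrix (Fin m ⊕ Unit) (Fin m ⊕ Unit) (ZMod 2))

/-- `#ker Nᵀ = #ker N` over `𝔽₂` (row rank = column rank), any finite index type. [folklore] -/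
theorem card_ker_transpose_eq' {ι : Type*} [Fintype ι] [DecidableEq ι] (M : Matrix ι ι (ZMod 2)) :
    Fintype.card {v : ι → ZMod 2 // Mᵀ *ᵥ v = 0} = Fintype.card {v : ι → ZMod 2 // M *ᵥ v = 0} := by
  rw [card_ker_mulVec_eq_pow, card_ker_mulVec_eq_pow, Matrix.rank_transpose]

/-- The left kernel of a square matrix on `Fin m ⊕ Unit` with ZERO last row: `(w; ε)` is in it iff `Σ_j w_j • N_{(inl j)} = 0` — the last
coordinate is free. [folklore] -/
theorem transpose_mulVec_eq_zero_iff (hN : ∀ u, N (Sum.inr u) = 0) (v : Fin m ⊕ Unit → ZMod 2) :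
    Nᵀ *ᵥ v = 0 ↔ (∑ j, v (Sum.inl j) • N (Sum.inl j)) = 0 := by
  rw [Matrix.mulVec_transpose, Matrix.vecMul_eq_sum, Fintype.sum_sum_type]
  have h0 : (∑ u : Unit, v (Sum.inr u) • N (Sum.inr u)) = 0 :=
    Finset.sum_eq_zero fun u _ => by rw [hN u, smul_zero]
  rw [h0, add_zero]

/-- `#ker Nᵀ = 2 · #{w : Σ_j w_j • N_{(inl j)} = 0}` for a square matrix on `Fin m ⊕ Unit` with zero last row. [folklore] -/
theorem card_ker_transpose_eq_two_mul (hN : ∀ u, N (Sum.inr u) = 0) :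
    Fintype.card {v : Fin m ⊕ Unit → ZMod 2 // Nᵀ *ᵥ v = 0} =
      2 * Fintype.card {w : Fin m → ZMod 2 // (∑ j, w j • N (Sum.inl j)) = 0} := by
  let e : {v : Fin m ⊕ Unit → ZMod 2 // Nᵀ *ᵥ v = 0} ≃ ({w : Fin m → ZMod 2 // (∑ j, w j • N (Sum.inl j)) = 0} × ZMod 2) :=
    { toFun := fun v => (⟨fun j => v.1 (Sum.inl j), (transpose_mulVec_eq_zero_iff N hN v.1).mp v.2⟩, v.1 (Sum.inr ()))
      invFun := fun p => ⟨Sum.elim p.1.1 (fun _ => p.2), by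
        rw [transpose_mulVec_eq_zero_iff N hN]
        simpa only [Sum.elim_inl] using p.1.2⟩
      left_inv := fun v => by
        apply Subtype.ext
        funext c
        rcases c with j | u
        · rfl
        · rfl
      right_inv := fun p => by
        rcases p with ⟨⟨w, hw⟩, ε⟩
        rfl }
  rw [Fintype.card_congr e, Fintype.card_prod, ZMod.card, mul_comm]

/-- **Independent rows**: if `#ker N = 2` (zero last row), then `Σ_j w_j • N_{(inl j)} = 0` forces `w = 0`. [folklore] -/
theorem eq_zero_of_sum_smul_row_eq_zero (hN : ∀ u, N (Sum.inr u) = 0)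
    (hcard : Fintype.card {v : Fin m ⊕ Unit → ZMod 2 // N *ᵥ v = 0} = 2) {w : Fin m → ZMod 2}
    (hw : (∑ j, w j • N (Sum.inl j)) = 0) : w = 0 := by
  have h2 : 2 * Fintype.card {w : Fin m → ZMod 2 // (∑ j, w j • N (Sum.inl j)) = 0} = 2 := by
    rw [← card_ker_transpose_eq_two_mul N hN, card_ker_transpose_eq', hcard]
  have h1 : Fintype.card {w : Fin m → ZMod 2 // (∑ j, w j • N (Sum.inl j)) = 0} = 1 := by omega
  have hsub := Fintype.card_le_one_iff_subsingleton.mp h1.le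
  have e : (⟨w, hw⟩ : {w : Fin m → ZMod 2 // (∑ j, w j • N (Sum.inl j)) = 0}) = ⟨0, by simp⟩ := Subsingleton.elim _ _
  exact congrArg Subtype.val e

/-- **Dependent rows**: if `#ker N ≠ 2` (zero last row; `#ker N ≥ 2` always), some `w ≠ 0` has `Σ_j w_j • N_{(inl j)} = 0`. [folklore] -/
theorem exists_sum_smul_row_eq_zero (hN : ∀ u, N (Sum.inr u) = 0)
    (hcard : Fintype.card {v : Fin m ⊕ Unit → ZMod 2 // N *ᵥ v = 0} ≠ 2) :
    ∃ w : Fin m → ZMod 2, w ≠ 0 ∧ (∑ j, w j • N (Sum.inl j)) = 0 := by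
  have hpos : 0 < Fintype.card {w : Fin m → ZMod 2 // (∑ j, w j • N (Sum.inl j)) = 0} :=
    Fintype.card_pos_iff.mpr ⟨⟨0, by simp⟩⟩
  have hne1 : Fintype.card {w : Fin m → ZMod 2 // (∑ j, w j • N (Sum.inl j)) = 0} ≠ 1 := by
    intro h1
    apply hcard
    rw [← card_ker_transpose_eq' N, card_ker_transpose_eq_two_mul N hN, h1]
  have hlt : 1 < Fintype.card {w : Fin m → ZMod 2 // (∑ j, w j • N (Sum.inl j)) = 0} := by omega
  obtain ⟨a, b, hab⟩ := Fintype.exists_pair_of_one_lt_card hlt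
  by_cases ha : a.1 = 0
  · refine ⟨b.1, fun hb => hab (Subtype.ext (ha.trans hb.symm)), b.2⟩
  · exact ⟨a.1, ha, a.2⟩

end LinearAlgebra

/-! ## §2 The block `d = 2q₁⋯q_m ≡ 6 (mod 8)` through a ring class dictionary `ρ` (abstract target group)

The dictionary is taken on an ABSTRACT finite abelian group `G` with the three clauses (RC1) onto / kernel `Gal(ℍ′_n/H′_d)` and (RC3)
«`L_d(i)`-trivial ⟺ `ρ g = ρ h·ρ h` with `h(i) = i`» of `RingClassFourBlockSpec` as separate hypotheses `hρ1 hρ2 hρ3`; the consumer instantiates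
`G := RingClassGroup (GenusField d) 4 = Pic(𝒪₄)` (`hRC.1`, `hRC.2.1`, `hRC.2.2.2`). -/

section SixBlock

variable {n : ℕ} (D : GenusPointData n)
variable {m : ℕ} (q : Fin m → ℕ) (hq : ∀ j, (q j).Prime) (hqodd : ∀ j, Odd (q j)) (hqinj : Function.Injective q)
variable {d : ℕ} {z : APoint D.H} {Φ : Finset (D.H ≃ₐ[ℚ] D.H)} {ΓH ΓH' : Subgroup (D.H ≃ₐ[ℚ] D.H)} {σ c : D.H ≃ₐ[ℚ] D.H}
variable {G : Type*} [CommGroup G] {ρ : D.galK d →* G}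

/-- The bit vector `x_d(g) = ([g moves i√−q_i])_i ; [g moves i√−2])` is ADDITIVE on `Gal(ℍ′_n/K_d)` (each `i√−q`, `i√−2` is fixed or negated).
[cite: TianYuanZhang2017, §3.1 (p0011 L60–L64)] -/
theorem bits_six_mul (hd : d ∈ n.divisors) (hprod : 2 * ∏ j, q j = d) (a b : D.galK d) :
    Sum.elim (fun i => if ((a * b : D.galK d) : D.H ≃ₐ[ℚ] D.H) (D.im * D.sqrtNeg (q i)) = D.im * D.sqrtNeg (q i) then (0 : ZMod 2) else 1)
        (fun (_ : Unit) => if ((a * b : D.galK d) : D.H ≃ₐ[ℚ] D.H) (D.im * D.sqrtNeg 2) = D.im * D.sqrtNeg 2 then (0 : ZMod 2) else 1) =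
      Sum.elim (fun i => if (a : D.H ≃ₐ[ℚ] D.H) (D.im * D.sqrtNeg (q i)) = D.im * D.sqrtNeg (q i) then (0 : ZMod 2) else 1)
          (fun (_ : Unit) => if (a : D.H ≃ₐ[ℚ] D.H) (D.im * D.sqrtNeg 2) = D.im * D.sqrtNeg 2 then (0 : ZMod 2) else 1) +
        Sum.elim (fun i => if (b : D.H ≃ₐ[ℚ] D.H) (D.im * D.sqrtNeg (q i)) = D.im * D.sqrtNeg (q i) then (0 : ZMod 2) else 1)
          (fun (_ : Unit) => if (b : D.H ≃ₐ[ℚ] D.H) (D.im * D.sqrtNeg 2) = D.im * D.sqrtNeg 2 then (0 : ZMod 2) else 1) := by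
  have hprod' : ∏ l, (Fin.cons 2 q : Fin (m + 1) → ℕ) l = d := by rw [prod_cons_two_eq q, hprod]
  have hqn' : ∀ l, (Fin.cons 2 q : Fin (m + 1) → ℕ) l ∈ n.divisors := mem_divisors_of_block (Fin.cons 2 q) hd hprod'
  have hqn : ∀ i, q i ∈ n.divisors := fun i => by simpa only [Fin.cons_succ] using hqn' i.succ
  have h2n : 2 ∈ n.divisors := by simpa only [Fin.cons_zero] using hqn' 0
  funext cc
  rcases cc with i | u
  · simp only [Sum.elim_inl, Pi.add_apply, Subgroup.coe_mul, AlgEquiv.mul_apply]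
    exact bit_comp ((a : D.H ≃ₐ[ℚ] D.H) : D.H →+* D.H) ((b : D.H ≃ₐ[ℚ] D.H) : D.H →+* D.H)
      (apply_im_mul_sqrtNeg_eq_or D _ (hqn i)) (apply_im_mul_sqrtNeg_eq_or D _ (hqn i)) (im_mul_sqrtNeg_ne_zero D (hqn i))
  · simp only [Sum.elim_inr, Pi.add_apply, Subgroup.coe_mul, AlgEquiv.mul_apply]
    exact bit_comp ((a : D.H ≃ₐ[ℚ] D.H) : D.H →+* D.H) ((b : D.H ≃ₐ[ℚ] D.H) : D.H →+* D.H)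
      (apply_im_mul_sqrtNeg_eq_or D _ h2n) (apply_im_mul_sqrtNeg_eq_or D _ h2n) (im_mul_sqrtNeg_ne_zero D h2n)

include hq hqodd hqinj in
/-- **Zero bits ⟺ trivial on `L_d(i) = ℚ(i, √2, √q_j : j)`** on `Gal(ℍ′_n/K_d)`, block `d = 2q₁⋯q_m`.
[cite: TianYuanZhang2017, §3.1 (p0011 L60–L64) and proof of Lemma 3.21 (p0020 L55–L58)] -/
theorem bits_six_eq_zero_iff_trivialOnL (hn : Squarefree n) (hd : d ∈ n.divisors) (hprod : 2 * ∏ j, q j = d) (a : D.galK d) :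
    Sum.elim (fun i => if (a : D.H ≃ₐ[ℚ] D.H) (D.im * D.sqrtNeg (q i)) = D.im * D.sqrtNeg (q i) then (0 : ZMod 2) else 1)
        (fun (_ : Unit) => if (a : D.H ≃ₐ[ℚ] D.H) (D.im * D.sqrtNeg 2) = D.im * D.sqrtNeg 2 then (0 : ZMod 2) else 1) = 0 ↔
      D.TrivialOnL d a := by
  have hprod' : ∏ l, (Fin.cons 2 q : Fin (m + 1) → ℕ) l = d := by rw [prod_cons_two_eq q, hprod]
  have hd0 : d ≠ 0 := fun h0 => by rw [h0] at hd; simp at hd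
  constructor
  · intro ha
    have hbits : ∀ l, (a : D.H ≃ₐ[ℚ] D.H) (D.im * D.sqrtNeg ((Fin.cons 2 q : Fin (m + 1) → ℕ) l)) =
        D.im * D.sqrtNeg ((Fin.cons 2 q : Fin (m + 1) → ℕ) l) := by
      intro l
      refine Fin.cases ?_ (fun i => ?_) l
      · have := congr_fun ha (Sum.inr ())
        by_contra hne
        simp only [Sum.elim_inr, Fin.cons_zero, Pi.zero_apply] at this hne
        rw [if_neg hne] at this; exact one_ne_zero this
      · have := congr_fun ha (Sum.inl i)
        by_contra hne
        simp only [Sum.elim_inl, Fin.cons_succ, Pi.zero_apply] at this hne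
        rw [if_neg hne] at this; exact one_ne_zero this
    exact trivialOnL_of_bits_eq_zero D (Fin.cons 2 q) (prime_cons_two q hq) (injective_cons_two q hqodd hqinj) hn hd hprod' a.2 hbits
  · intro hL
    have hfix : ∀ r : ℕ, r ∣ d → 1 < r → (a : D.H ≃ₐ[ℚ] D.H) (D.im * D.sqrtNeg r) = D.im * D.sqrtNeg r := by
      intro r hr h1
      rw [map_mul, hL.1, hL.2 r (Nat.mem_divisors.mpr ⟨hr, hd0⟩) h1]
    funext cc
    rcases cc with i | u
    · simp only [Sum.elim_inl, Pi.zero_apply]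
      rw [if_pos (hfix (q i) (hprod ▸ Dvd.dvd.mul_left (Finset.dvd_prod_of_mem q (mem_univ i)) 2) (hq i).one_lt)]
    · simp only [Sum.elim_inr, Pi.zero_apply]
      rw [if_pos (hfix 2 (hprod ▸ dvd_mul_right 2 _) one_lt_two)]

include hq hqinj in
/-- **Bit surjectivity** on `Gal(ℍ′_n/K_d)` for `d = 2q₁⋯q_m` (odd `q_j`): every vector of `𝔽₂^{m+1}` is the bit vector of some `g` fixing `√−d`.
[cite: TianYuanZhang2017, §3.1 (p0011 L60–L64)] [cite: Cox2013, Thm. 6.1] -/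
theorem exists_galK_bits_six_eq (hd : d ∈ n.divisors) (hprod : 2 * ∏ j, q j = d) (hq2 : ∀ j, q j ≠ 2)
    (v : Fin m ⊕ Unit → ZMod 2) : ∃ a : D.galK d,
    Sum.elim (fun i => if (a : D.H ≃ₐ[ℚ] D.H) (D.im * D.sqrtNeg (q i)) = D.im * D.sqrtNeg (q i) then (0 : ZMod 2) else 1)
        (fun (_ : Unit) => if (a : D.H ≃ₐ[ℚ] D.H) (D.im * D.sqrtNeg 2) = D.im * D.sqrtNeg 2 then (0 : ZMod 2) else 1) = v := by
  have hprod' : ∏ l, (Fin.cons 2 q : Fin (m + 1) → ℕ) l = d := by rw [prod_cons_two_eq q, hprod]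
  have hqn' : ∀ l, (Fin.cons 2 q : Fin (m + 1) → ℕ) l ∈ n.divisors := mem_divisors_of_block (Fin.cons 2 q) hd hprod'
  have hinj' : Function.Injective (Fin.cons 2 q : Fin (m + 1) → ℕ) := by
    intro a b hab
    induction a using Fin.cases with
    | zero =>
      induction b using Fin.cases with
      | zero => rfl
      | succ j => simp only [Fin.cons_zero, Fin.cons_succ] at hab; exact absurd hab.symm (hq2 j)
    | succ i =>
      induction b using Fin.cases with
      | zero => simp only [Fin.cons_zero, Fin.cons_succ] at hab; exact absurd hab (hq2 i)
      | succ j => simp only [Fin.cons_succ] at hab; rw [hqinj hab]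
  obtain ⟨g, hg, hgv⟩ := exists_mem_galK_bits_eq_of_prod D (Fin.cons 2 q) (prime_cons_two q hq) hinj' hqn' hd hprod'
    (Fin.cons (v (Sum.inr ())) (fun i => v (Sum.inl i)))
  refine ⟨⟨g, hg⟩, funext fun cc => ?_⟩
  rcases cc with i | u
  · have := hgv i.succ
    simp only [Fin.cons_succ] at this
    simpa only [Sum.elim_inl] using this
  · have := hgv 0
    simp only [Fin.cons_zero] at this
    simpa only [Sum.elim_inr] using this

/-- (RC1) as an equation: for `a, b ∈ Gal(ℍ′_n/K_d)`, `ρ a = ρ b ⟺ a·b⁻¹ ∈ Gal(ℍ′_n/H′_d)`. [cite: TianYuanZhang2017, Prop. 3.2 (2)] [cite: Cox2013, §9.A] -/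
theorem rho_eq_iff_mul_inv_mem (hρ2 : ∀ g : D.galK d, ρ g = 1 ↔ (g : D.H ≃ₐ[ℚ] D.H) ∈ ΓH') (a b : D.galK d) :
    ρ a = ρ b ↔ (a : D.H ≃ₐ[ℚ] D.H) * (b : D.H ≃ₐ[ℚ] D.H)⁻¹ ∈ ΓH' := by
  have h := hρ2 (a * b⁻¹)
  rw [map_mul, map_inv, mul_inv_eq_one] at h
  rw [h]
  exact Iff.rfl

include hq hqodd hqinj in
/-- **Bits factor through `ρ`**: `ρ a = ρ b` forces equal bit vectors (the kernel `Gal(ℍ′_n/H′_d)` is `L_d(i)`-trivial by (RC3) with `h = 1`).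
[cite: TianYuanZhang2017, Prop. 3.2 (2), proof of Lemma 3.21 (p0020 L55–L58)] [cite: Cox2013, §9.A] -/
theorem bits_six_eq_of_rho_eq (hn : Squarefree n) (hd : d ∈ n.divisors) (hprod : 2 * ∏ j, q j = d)
    (hρ3 : ∀ g : D.galK d, D.TrivialOnL d g ↔ ∃ h : D.galK d, (h : D.H ≃ₐ[ℚ] D.H) D.im = D.im ∧ ρ g = ρ h * ρ h)
    {a b : D.galK d} (hab : ρ a = ρ b) :
    Sum.elim (fun i => if (a : D.H ≃ₐ[ℚ] D.H) (D.im * D.sqrtNeg (q i)) = D.im * D.sqrtNeg (q i) then (0 : ZMod 2) else 1)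
        (fun (_ : Unit) => if (a : D.H ≃ₐ[ℚ] D.H) (D.im * D.sqrtNeg 2) = D.im * D.sqrtNeg 2 then (0 : ZMod 2) else 1) =
      Sum.elim (fun i => if (b : D.H ≃ₐ[ℚ] D.H) (D.im * D.sqrtNeg (q i)) = D.im * D.sqrtNeg (q i) then (0 : ZMod 2) else 1)
        (fun (_ : Unit) => if (b : D.H ≃ₐ[ℚ] D.H) (D.im * D.sqrtNeg 2) = D.im * D.sqrtNeg 2 then (0 : ZMod 2) else 1) := by
  -- `a⁻¹ b` lies in the kernel, hence is `L_d(i)`-trivial, hence has zero bits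
  have hker : ρ (a⁻¹ * b) = 1 := by rw [map_mul, map_inv, hab, inv_mul_cancel]
  have hL : D.TrivialOnL d ((a⁻¹ * b : D.galK d) : D.H ≃ₐ[ℚ] D.H) :=
    (hρ3 (a⁻¹ * b)).mpr ⟨1, by simp, by rw [hker, map_one, mul_one]⟩
  have h0 := (bits_six_eq_zero_iff_trivialOnL D q hq hqodd hqinj hn hd hprod (a⁻¹ * b)).mpr hL
  have hsplit := bits_six_mul D q hd hprod a (a⁻¹ * b)
  rw [h0, add_zero, mul_inv_cancel_left] at hsplit
  exact hsplit.symm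

include hq hqodd hqinj in
/-- **Squares ⟺ zero bits** ((RC3) read on the target group): `ρ a` is a square iff `a` has zero bit vector (iff `a` is trivial on `L_d(i)`).
[cite: TianYuanZhang2017, §3.1 (p0011 L1–L13), proof of Lemma 3.21 (p0020 L55–L58)] [cite: Cox2013, §9.A, Thm. 6.1] -/
theorem isSquare_rho_iff_bits_six_eq_zero (hn : Squarefree n) (hd : d ∈ n.divisors) (hprod : 2 * ∏ j, q j = d)
    (hρ1 : Function.Surjective ρ)
    (hρ3 : ∀ g : D.galK d, D.TrivialOnL d g ↔ ∃ h : D.galK d, (h : D.H ≃ₐ[ℚ] D.H) D.im = D.im ∧ ρ g = ρ h * ρ h)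
    (a : D.galK d) :
    IsSquare (ρ a) ↔
      Sum.elim (fun i => if (a : D.H ≃ₐ[ℚ] D.H) (D.im * D.sqrtNeg (q i)) = D.im * D.sqrtNeg (q i) then (0 : ZMod 2) else 1)
        (fun (_ : Unit) => if (a : D.H ≃ₐ[ℚ] D.H) (D.im * D.sqrtNeg 2) = D.im * D.sqrtNeg 2 then (0 : ZMod 2) else 1) = 0 := by
  constructor
  · rintro ⟨w, hw⟩
    obtain ⟨b, rfl⟩ := hρ1 w
    rw [← map_mul] at hw
    rw [bits_six_eq_of_rho_eq D q hq hqodd hqinj hn hd hprod hρ3 hw, bits_six_mul D q hd hprod b b]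
    funext cc
    exact CharTwo.add_self_eq_zero _
  · intro h0
    have hL := (bits_six_eq_zero_iff_trivialOnL D q hq hqodd hqinj hn hd hprod a).mp h0
    obtain ⟨h, -, hh⟩ := (hρ3 a).mp hL
    exact ⟨ρ h, hh⟩

/-- **`χ_d(a) = 1 ⟺ ρ(a)^{2g(d)} = ρ(σ)`** for `a ∈ Gal(ℍ′_n/K_d)` ((RC1): `Gal(ℍ′_n/H′_d)` is the kernel of `ρ`).
[cite: TianYuanZhang2017, Prop. 3.2 (2), proof of Lemma 3.21 (p0020 L55–L62)] [cite: Cox2013, §9.A] -/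
theorem sqChi_mem_iff_pow_rho_eq (hρ2 : ∀ g : D.galK d, ρ g = 1 ↔ (g : D.H ≃ₐ[ℚ] D.H) ∈ ΓH') (hσK : σ ∈ D.galK d)
    (a : D.galK d) :
    ((a : D.H ≃ₐ[ℚ] D.H) * a) ^ gK d * σ⁻¹ ∈ ΓH' ↔ (ρ a) ^ (2 * gK d) = ρ ⟨σ, hσK⟩ := by
  have h := rho_eq_iff_mul_inv_mem D hρ2 ((a * a) ^ gK d) ⟨σ, hσK⟩
  rw [map_pow, map_mul, ← pow_two, ← pow_mul] at h
  rw [h]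
  exact Iff.rfl

/-- `ρ(σ) ≠ 1` (`σ ∉ Gal(ℍ′_n/H′_d)`: it moves `z_d`) and `ρ(σ)·ρ(σ) = 1` ((G6)). [cite: TianYuanZhang2017, Thm. 3.6 (2), Prop. 3.2 (2)] -/
theorem rho_sigma_ne_one_and_mul_self (h : D.CMBlockSpec d z Φ ΓH ΓH' σ c)
    (hρ2 : ∀ g : D.galK d, ρ g = 1 ↔ (g : D.H ≃ₐ[ℚ] D.H) ∈ ΓH') :
    ρ ⟨σ, D.sigma_mem_galK_of_cmBlockSpec h⟩ ≠ 1 ∧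
      ρ ⟨σ, D.sigma_mem_galK_of_cmBlockSpec h⟩ * ρ ⟨σ, D.sigma_mem_galK_of_cmBlockSpec h⟩ = 1 := by
  have hσΓ' : σ ∉ ΓH' := sigma_not_mem D ΓH' z σ h.2.2.1.1 h.2.2.2.2.2.1.2.2
  refine ⟨fun h1 => hσΓ' ((hρ2 _).mp h1), ?_⟩
  rw [← map_mul, hρ2]
  exact h.2.2.2.2.2.1.2.1

/-- `ρ(σ)` is a SQUARE: `σ ≡ θ·θ` for the lift `θ` of `σ_{1+ϖ}` (`ThetaBlockSpec`). [cite: TianYuanZhang2017, Prop. 3.2 (2) (p0010 L111–L113)] -/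
theorem isSquare_rho_sigma (h : D.CMBlockSpec d z Φ ΓH ΓH' σ c) (hρ2 : ∀ g : D.galK d, ρ g = 1 ↔ (g : D.H ≃ₐ[ℚ] D.H) ∈ ΓH')
    {θ : D.H ≃ₐ[ℚ] D.H} (hθd : θ (D.sqrtNeg d) = D.sqrtNeg d) (hθ : θ * θ * σ⁻¹ ∈ ΓH') :
    IsSquare (ρ ⟨σ, D.sigma_mem_galK_of_cmBlockSpec h⟩) := by
  refine ⟨ρ ⟨θ, hθd⟩, ?_⟩
  rw [← map_mul, eq_comm, rho_eq_iff_mul_inv_mem D hρ2]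
  exact hθ

include hq hqodd hqinj in
/-- **The squares of the target group number `2g(d)`**: through `ρ` they are the classes of the `L_d(i)`-trivial automorphisms ((RC3)), i.e.
`Φ̄₀ ⊔ Φ̄₀σ̄` exactly once ((G2), (G7)), `#Φ₀ = g(d)` ((G1)). [cite: TianYuanZhang2017, §3.1 (p0011 L1–L13: 2Cl′, Φ₀), proof of Lemma 3.21 (p0020 L55–L62)] -/
theorem natCard_isSquare_eq (hn : Squarefree n) (hd : d ∈ n.divisors) (hd1 : 1 < d) (hprod : 2 * ∏ j, q j = d)
    (h : D.CMBlockSpec d z Φ ΓH ΓH' σ c) (hρ1 : Function.Surjective ρ)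
    (hρ2 : ∀ g : D.galK d, ρ g = 1 ↔ (g : D.H ≃ₐ[ℚ] D.H) ∈ ΓH')
    (hρ3 : ∀ g : D.galK d, D.TrivialOnL d g ↔ ∃ h : D.galK d, (h : D.H ≃ₐ[ℚ] D.H) D.im = D.im ∧ ρ g = ρ h * ρ h)
    {θ : D.H ≃ₐ[ℚ] D.H} (hθd : θ (D.sqrtNeg d) = D.sqrtNeg d) (hθ : θ * θ * σ⁻¹ ∈ ΓH') :
    Nat.card {y : G // IsSquare y} = 2 * gK d := by
  have hcard := h.1.2
  have hΦL := h.2.1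
  have hrep := h.2.2.2.2.2.2.1
  have huniq := h.2.2.2.2.2.2.2
  have hdd : d ∈ d.divisors := Nat.mem_divisors_self d (by omega)
  have hK : ∀ x : D.H ≃ₐ[ℚ] D.H, D.TrivialOnL d x → x ∈ D.galK d := fun x hx => (D.mem_galK_iff d x).mpr (hx.2 d hdd hd1)
  set κ := ρ ⟨σ, D.sigma_mem_galK_of_cmBlockSpec h⟩ with hκdef
  obtain ⟨hκ1, hκκ⟩ := rho_sigma_ne_one_and_mul_self D h hρ2
  have hκsq : IsSquare κ := isSquare_rho_sigma D h hρ2 hθd hθ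
  -- the class map on automorphisms (junk value off the stabiliser)
  let r : (D.H ≃ₐ[ℚ] D.H) → G := fun t => if ht : t ∈ D.galK d then ρ ⟨t, ht⟩ else 1
  have hr : ∀ t (ht : t ∈ D.galK d), r t = ρ ⟨t, ht⟩ := fun t ht => by simp only [r, dif_pos ht]
  set F : Finset G := Φ.image r ∪ Φ.image (fun t => r t * κ) with hF
  have hinj1 : Set.InjOn r ↑Φ := by
    intro t₁ ht₁ t₂ ht₂ h12
    have hK₁ := hK t₁ (hΦL t₁ ht₁); have hK₂ := hK t₂ (hΦL t₂ ht₂)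
    rw [hr t₁ hK₁, hr t₂ hK₂, rho_eq_iff_mul_inv_mem D hρ2] at h12
    exact huniq t₁ ht₁ t₂ ht₂ (Or.inl h12)
  have hinj2 : Set.InjOn (fun t => r t * κ) ↑Φ := by
    intro t₁ ht₁ t₂ ht₂ h12
    exact hinj1 ht₁ ht₂ (mul_right_cancel h12)
  have hdisj : Disjoint (Φ.image r) (Φ.image (fun t => r t * κ)) := by
    rw [Finset.disjoint_left]
    intro u hu1 hu2
    obtain ⟨t₁, ht₁, e1⟩ := Finset.mem_image.mp hu1
    obtain ⟨t₂, ht₂, e2⟩ := Finset.mem_image.mp hu2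
    have hK₁ := hK t₁ (hΦL t₁ ht₁); have hK₂ := hK t₂ (hΦL t₂ ht₂)
    have h12 : ρ ⟨t₁, hK₁⟩ = ρ (⟨t₂, hK₂⟩ * ⟨σ, D.sigma_mem_galK_of_cmBlockSpec h⟩) := by
      rw [map_mul, ← hκdef, ← hr t₁ hK₁, ← hr t₂ hK₂, e1, e2]
    rw [rho_eq_iff_mul_inv_mem D hρ2] at h12
    have ht : t₁ = t₂ := huniq t₁ ht₁ t₂ ht₂ (Or.inr h12)
    subst ht
    rw [← e1] at e2
    exact hκ1 (mul_left_cancel (a := r t₁) (by rw [mul_one]; exact e2))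
  have hFcard : F.card = 2 * gK d := by
    rw [hF, Finset.card_union_of_disjoint hdisj, Finset.card_image_of_injOn hinj1, Finset.card_image_of_injOn hinj2, hcard]
    ring
  have hTF : ({y : G | IsSquare y} : Set G) = ↑F := by
    ext y
    rw [Set.mem_setOf_eq, hF, Finset.coe_union, Finset.coe_image, Finset.coe_image, Set.mem_union, Set.mem_image, Set.mem_image]
    constructor
    · rintro ⟨w, hw⟩
      obtain ⟨b, rfl⟩ := hρ1 w
      rw [← map_mul] at hw
      obtain ⟨t, ht, hbt | hbt⟩ := hrep _ (trivialOnL_mul_self_of_mem_divisors D (b : D.H ≃ₐ[ℚ] D.H) hd)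
      · refine Or.inl ⟨t, Finset.mem_coe.mpr ht, ?_⟩
        rw [hr t (hK t (hΦL t ht)), eq_comm, hw, rho_eq_iff_mul_inv_mem D hρ2]
        exact hbt
      · refine Or.inr ⟨t, Finset.mem_coe.mpr ht, ?_⟩
        rw [hr t (hK t (hΦL t ht)), hκdef, ← map_mul, eq_comm, hw, rho_eq_iff_mul_inv_mem D hρ2]
        exact hbt
    · rintro (⟨t, ht, rfl⟩ | ⟨t, ht, rfl⟩)
      · have hKt := hK t (hΦL t (Finset.mem_coe.mp ht))
        rw [hr t hKt]
        exact (isSquare_rho_iff_bits_six_eq_zero D q hq hqodd hqinj hn hd hprod hρ1 hρ3 ⟨t, hKt⟩).mpr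
          ((bits_six_eq_zero_iff_trivialOnL D q hq hqodd hqinj hn hd hprod ⟨t, hKt⟩).mpr (hΦL t (Finset.mem_coe.mp ht)))
      · have hKt := hK t (hΦL t (Finset.mem_coe.mp ht))
        rw [hr t hKt]
        exact ((isSquare_rho_iff_bits_six_eq_zero D q hq hqodd hqinj hn hd hprod hρ1 hρ3 ⟨t, hKt⟩).mpr
          ((bits_six_eq_zero_iff_trivialOnL D q hq hqodd hqinj hn hd hprod ⟨t, hKt⟩).mpr (hΦL t (Finset.mem_coe.mp ht)))).mul hκsq
  rw [← Set.coe_setOf, hTF, Finset.coe_sort_coe, Nat.card_eq_finsetCard, hFcard]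

end SixBlock

end Summit.BirchSwinnertonDyer.PrintCf2.MoverAssembly

end
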